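import Literature.Analysis.FluidPDE.ParallelShearFlow
import Literature.Barriers.NavierStokesRegularity.GalileanFrameSlotFamily
import HarnessLib

/-!
# Barrier family: a coordinate gauge is not a symmetry of the Navier–Stokes system — the cubic shear
# gauge conjugates the uniform stream to a planar divergence-free field that admits no pressure
# (Acheson 1990 §2.3 (2.9); Fushchich–Shtelen–Slavutsky 1991 §1; Majda–Bertozzi 2002 §1.2)

Family file of the barrier entry `DiffeomorphismNonInvariance` (catalogue `NavierStokesRegularity`,
D-0021; D-0090 NS-CLAIMS cell, salvage seat `ns-claims-salvage-p6`, METHOD LEVEL, everything PROVED).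
The entry file `DiffeomorphismNonInvariance.lean` carries the structured block, the printed sources and
the packaged `Prop`; this file carries the kernel facts (namespace `…NavierStokesRegularity.DiffeoGauge`):

* `eq_of_gradient_eq_smul_single` — Acheson (2.9), necessity: `∇q = K(y₁) e₀` everywhere ⇒ `K`
  constant («`∂p/∂x` must be a function of `t` alone»);
* `pushforward ψ ψinv v y = Dψ(ψ⁻¹y)·v(ψ⁻¹y)`, `pullback ψ ψinv = pushforward ψinv ψ`;
* the cubic shear gauge `shearMap cubic x = x + (x₁³/6) e₀` (smooth, polynomial inverse, unipotent
  differential `v ↦ v + v₁(x₁²/2) e₀`), the uniform stream `c e₁` (an exact solution for every `ν`),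
  and their conjugate `bentStream c = (c y₁²/2) e₀ + c e₁` (divergence-free, planar,
  `(v·∇)v = c² y₁ e₀`, `Δv = c e₀`);
* `not_isClassicalNSSolutionOn_bentStream`: for `c ≠ 0`, every real `ν`, every nonempty time set and
  every pressure, `bentStream c` is not a classical Navier–Stokes / Euler velocity (the forced
  pressure gradient `(νc − c²y₁) e₀` is not a gradient);
* the transfer laws `PushforwardLaw` / `PullbackLaw` (time-dependent gauge families allowed) and
  their refutations `not_pushforwardLaw` / `not_pullbackLaw` on every nonempty time set of unique
  differentiability.

WHAT THIS IS NOT: not a claim about NS regularity or blow-up; not a claim about any author beyond the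
typed locator.
-/

noncomputable section

open Set Function InnerProductSpace
open scoped ContDiff Laplacian RealInnerProductSpace

/-! ### Acheson (2.9), necessity: a pressure gradient `K(x₁) e₀` is constant in `x₁` -/

namespace Literature.Barriers.NavierStokesRegularity.DiffeoGauge

open Literature.Analysis.FluidPDE Literature.Analysis.FluidPDE.ParallelShear

/-- If a differentiable scalar field `q` on `ℝ³` has gradient `∇q(x) = K(x₁) e₀` everywhere, then `q`
is constant along `e₁`: `q(x + b e₁) = q(x)` (its derivative along `e₁` is `⟪∇q, e₁⟫ = 0`).
[cite: Acheson1990, §2.3 eq. (2.9)] -/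
theorem apply_add_smul_single_one {q : E3 → ℝ} (hq : Differentiable ℝ q) {K : ℝ → ℝ}
    (hK : ∀ x : E3, gradient q x = K (x 1) • EuclideanSpace.single (0 : Fin 3) (1 : ℝ))
    (x : E3) (b : ℝ) :
    q (x + b • EuclideanSpace.single (1 : Fin 3) (1 : ℝ)) = q x := by
  have hderiv : ∀ b : ℝ,
      HasDerivAt (fun b : ℝ => q (x + b • EuclideanSpace.single (1 : Fin 3) (1 : ℝ))) 0 b := by
    intro b
    have hline : HasDerivAt (fun b : ℝ => x + b • EuclideanSpace.single (1 : Fin 3) (1 : ℝ))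
        (EuclideanSpace.single (1 : Fin 3) (1 : ℝ)) b := by
      simpa using ((hasDerivAt_id b).smul_const (EuclideanSpace.single (1 : Fin 3) (1 : ℝ))).const_add x
    have hqd : HasFDerivAt q (fderiv ℝ q (x + b • EuclideanSpace.single (1 : Fin 3) (1 : ℝ)))
        (x + b • EuclideanSpace.single (1 : Fin 3) (1 : ℝ)) := (hq _).hasFDerivAt
    have hcomp := hqd.comp_hasDerivAt b hline
    have hval : fderiv ℝ q (x + b • EuclideanSpace.single (1 : Fin 3) (1 : ℝ))
        (EuclideanSpace.single (1 : Fin 3) (1 : ℝ)) = 0 := by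
      have h1 : fderiv ℝ q (x + b • EuclideanSpace.single (1 : Fin 3) (1 : ℝ))
          (EuclideanSpace.single (1 : Fin 3) (1 : ℝ)) =
          ⟪gradient q (x + b • EuclideanSpace.single (1 : Fin 3) (1 : ℝ)),
            EuclideanSpace.single (1 : Fin 3) (1 : ℝ)⟫ := by
        rw [gradient, InnerProductSpace.toDual_symm_apply]
      rw [h1, hK]
      simp [real_inner_smul_left, EuclideanSpace.inner_single_left]
    rw [hval] at hcomp
    exact hcomp
  have hdiff : Differentiable ℝ (fun b : ℝ => q (x + b • EuclideanSpace.single (1 : Fin 3) (1 : ℝ))) :=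
    fun b => (hderiv b).differentiableAt
  have h := is_const_of_deriv_eq_zero hdiff (fun b => (hderiv b).deriv) b 0
  simpa using h

/-- **Acheson (2.9), «∂p/∂x must be a function of t alone»**: if `∇q(x) = K(x₁) e₀` for all `x`
(a stream-wise pressure gradient depending on the shear coordinate only), then `K` is constant —
`q` is constant along `e₁`, so `∇q` is invariant under `e₁`-translations.
[cite: Acheson1990, §2.3 eq. (2.9)] -/
theorem eq_of_gradient_eq_smul_single {q : E3 → ℝ} (hq : Differentiable ℝ q) {K : ℝ → ℝ}
    (hK : ∀ x : E3, gradient q x = K (x 1) • EuclideanSpace.single (0 : Fin 3) (1 : ℝ))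
    (a b : ℝ) : K a = K b := by
  have hfun : (fun z : E3 => q (z + (b - a) • EuclideanSpace.single (1 : Fin 3) (1 : ℝ))) = q :=
    funext fun z => apply_add_smul_single_one hq hK z (b - a)
  have h1 : gradient (fun z : E3 => q (z + (b - a) • EuclideanSpace.single (1 : Fin 3) (1 : ℝ)))
      (a • EuclideanSpace.single (1 : Fin 3) (1 : ℝ)) =
      gradient q (a • EuclideanSpace.single (1 : Fin 3) (1 : ℝ) +
        (b - a) • EuclideanSpace.single (1 : Fin 3) (1 : ℝ)) := by
    unfold gradient
    rw [fderiv_comp_add_right]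
  rw [hfun, hK, hK] at h1
  have h2 := congrArg (fun v : E3 => v 0) h1
  simpa using h2


/-! ### Push-forward of a vector field by a coordinate change -/

/-- The push-forward of a vector field `v` on `ℝ³` by a map `ψ` with (two-sided) inverse `ψinv`:
`(ψ_* v)(y) = Dψ(ψ⁻¹ y) · v(ψ⁻¹ y)` (the coordinate expression of the differential-geometric
push-forward; display (6) p. 11 of the C170 text). [folklore] -/
def pushforward (ψ ψinv : E3 → E3) (v : E3 → E3) (y : E3) : E3 :=
  fderiv ℝ ψ (ψinv y) (v (ψinv y))

/-- The pull-back `ψ^* v = (ψ⁻¹)_* v`: `(ψ^* v)(x) = Dψ⁻¹(ψ x) · v(ψ x)`. [folklore] -/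
def pullback (ψ ψinv : E3 → E3) (v : E3 → E3) : E3 → E3 :=
  pushforward ψinv ψ v

/-! ### The shear MAP `x ↦ x + h(x₁) e₀` (a volume-preserving diffeomorphism of `ℝ³`) -/

/-- The shear map `ψ_h(x) = x + h(x₁) e₀`: displacement along `e₀` by an amount depending on the
coordinate `x₁` only; `Dψ_h = I + h′(x₁) e₀ ⊗ e₁*` is unipotent (`det = 1`), and
`ψ_h⁻¹(y) = y − h(y₁) e₀`. [folklore] -/
def shearMap (h : ℝ → ℝ) (x : E3) : E3 :=
  x + h (x 1) • EuclideanSpace.single (0 : Fin 3) (1 : ℝ)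

/-- The inverse shear map `y ↦ y − h(y₁) e₀`. [folklore] -/
def shearMapInv (h : ℝ → ℝ) (y : E3) : E3 :=
  y - h (y 1) • EuclideanSpace.single (0 : Fin 3) (1 : ℝ)

/-- The shear map does not move the shear coordinate: `(ψ_h x)₁ = x₁`. [folklore] -/
@[simp]
private theorem shearMap_apply_one (h : ℝ → ℝ) (x : E3) : shearMap h x 1 = x 1 := by
  simp [shearMap]

/-- `(ψ_h⁻¹ y)₁ = y₁`. [folklore] -/
@[simp]
private theorem shearMapInv_apply_one (h : ℝ → ℝ) (y : E3) : shearMapInv h y 1 = y 1 := by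
  simp [shearMapInv]

/-- `ψ_h⁻¹ ∘ ψ_h = id` (the gauge is a genuine point transformation of `ℝ³`; cf. the finite
transformations generated by (1.2)–(1.3), among which it is NOT). [cite: FushchichShtelenSlavutsky1991, §1 eqs. (1.2)–(1.3) p. 971] -/
theorem leftInverse_shearMap (h : ℝ → ℝ) : LeftInverse (shearMapInv h) (shearMap h) := by
  intro x; rw [shearMapInv, shearMap_apply_one, shearMap]; abel

/-- `ψ_h ∘ ψ_h⁻¹ = id`. [cite: FushchichShtelenSlavutsky1991, §1 eqs. (1.2)–(1.3) p. 971] -/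
theorem rightInverse_shearMap (h : ℝ → ℝ) : RightInverse (shearMapInv h) (shearMap h) := by
  intro y; rw [shearMap, shearMapInv_apply_one, shearMapInv]; abel

/-- The shear map is smooth when `h` is. [cite: FushchichShtelenSlavutsky1991, §1 eqs. (1.2)–(1.3) p. 971] -/
theorem contDiff_shearMap {h : ℝ → ℝ} (hh : ContDiff ℝ ∞ h) : ContDiff ℝ ∞ (shearMap h) :=
  contDiff_id.add ((hh.comp (EuclideanSpace.proj (1 : Fin 3) : E3 →L[ℝ] ℝ).contDiff).smul
    contDiff_const)

/-- The inverse shear map is smooth when `h` is. [cite: FushchichShtelenSlavutsky1991, §1 eqs. (1.2)–(1.3) p. 971] -/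
theorem contDiff_shearMapInv {h : ℝ → ℝ} (hh : ContDiff ℝ ∞ h) : ContDiff ℝ ∞ (shearMapInv h) :=
  contDiff_id.sub ((hh.comp (EuclideanSpace.proj (1 : Fin 3) : E3 →L[ℝ] ℝ).contDiff).smul
    contDiff_const)

/-- `Dψ_h(x) v = v + v₁ h′(x₁) e₀`. [folklore] -/
private theorem fderiv_shearMap_apply {h : ℝ → ℝ} (hh : Differentiable ℝ h) (x v : E3) :
    fderiv ℝ (shearMap h) x v = v + (v 1 * deriv h (x 1)) • EuclideanSpace.single (0 : Fin 3) (1 : ℝ) := by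
  have h1 : HasFDerivAt (shearMap h)
      (ContinuousLinearMap.id ℝ E3 + (EuclideanSpace.proj (1 : Fin 3) : E3 →L[ℝ] ℝ).smulRight
        (deriv h (x 1) • EuclideanSpace.single (0 : Fin 3) (1 : ℝ))) x :=
    (ContinuousLinearMap.id ℝ E3).hasFDerivAt.add (hasFDerivAt_profile (hh (x 1)).hasDerivAt)
  rw [h1.fderiv]
  simp [smul_smul]

/-- The cubic profile `h(s) = s³/6` (so `h′(s) = s²/2`, `h″(s) = s`, `h‴ ≡ 1`). [folklore] -/
def cubic (s : ℝ) : ℝ := s ^ 3 / 6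

/-- `h′(s) = s²/2`. [folklore] -/
private theorem hasDerivAt_cubic (s : ℝ) : HasDerivAt cubic (s ^ 2 / 2) s := by
  refine ((hasDerivAt_pow 3 s).div_const 6).congr_deriv ?_
  push_cast; ring

/-- `deriv h = fun s => s²/2`. [folklore] -/
private theorem deriv_cubic : deriv cubic = fun s => s ^ 2 / 2 :=
  funext fun s => (hasDerivAt_cubic s).deriv

/-- `h` is smooth. [folklore] -/
private theorem contDiff_cubic : ContDiff ℝ ∞ cubic := by
  unfold cubic; fun_prop

/-- The BENT STREAM `v_c(y) = (c y₁²/2) e₀ + c e₁`: the push-forward of the uniform stream `c e₁` by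
the cubic shear map (`pushforward_shearMap_stream`). It is a steady planar field (independent of
`y₂`, no `e₂`-component). [folklore] -/
def bentStream (c : ℝ) (y : E3) : E3 :=
  (c * (y 1) ^ 2 / 2) • EuclideanSpace.single (0 : Fin 3) (1 : ℝ) +
    c • EuclideanSpace.single (1 : Fin 3) (1 : ℝ)

/-- **How a shear gauge acts on a uniform field**: `(ψ_h)_* w = w + w₁ h′(y₁) e₀` for a constant
field `w` and any differentiable `h` (the finite point transformation `x ↦ x + h(x₁)e₀` acting on the
velocity as a vector field; compare the generators (1.2)–(1.3), all of which act on `u` by at most a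
time-dependent shift, a rotation or a scaling). [cite: FushchichShtelenSlavutsky1991, §1 eqs. (1.2)–(1.3) p. 971] -/
theorem pushforward_shearMap_const {h : ℝ → ℝ} (hh : Differentiable ℝ h) (w : E3) :
    pushforward (shearMap h) (shearMapInv h) (fun _ : E3 => w) =
      fun y => w + (w 1 * deriv h (y 1)) • EuclideanSpace.single (0 : Fin 3) (1 : ℝ) := by
  funext y
  rw [pushforward, fderiv_shearMap_apply hh, shearMapInv_apply_one]

/-- `h(s) = s³/6` is smooth. [cite: FushchichShtelenSlavutsky1991, §1 eqs. (1.2)–(1.3) p. 971] -/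
theorem contDiff_cubic' : ContDiff ℝ ∞ cubic := contDiff_cubic

/-- **The conjugated field**: `(ψ_h)_* (c e₁) = v_c` for the cubic shear map.
[cite: FushchichShtelenSlavutsky1991, §1 eqs. (1.2)–(1.3) p. 971] -/
theorem pushforward_shearMap_stream (c : ℝ) :
    pushforward (shearMap cubic) (shearMapInv cubic)
        (fun _ : E3 => c • EuclideanSpace.single (1 : Fin 3) (1 : ℝ)) = bentStream c := by
  rw [pushforward_shearMap_const (contDiff_cubic.differentiable (by simp)), deriv_cubic]
  funext y
  rw [bentStream]
  simp only [PiLp.smul_apply, PiLp.single_apply, if_true, smul_eq_mul, mul_one]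
  rw [add_comm]
  congr 1
  ring_nf

/-- The profile part `y ↦ (c y₁²/2) e₀` has derivative `v ↦ v₁ (c y₁) e₀`. [cite: Acheson1990, §2.3 eq. (2.8)] -/
theorem hasFDerivAt_bentStream (c : ℝ) (y : E3) :
    HasFDerivAt (bentStream c)
      ((EuclideanSpace.proj (1 : Fin 3) : E3 →L[ℝ] ℝ).smulRight
        ((c * y 1) • EuclideanSpace.single (0 : Fin 3) (1 : ℝ))) y := by
  have hψ : HasDerivAt (fun s : ℝ => c * s ^ 2 / 2) (c * y 1) (y 1) := by
    have h := ((hasDerivAt_pow 2 (y 1)).const_mul c).div_const 2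
    refine h.congr_deriv ?_
    push_cast
    ring
  have h := (hasFDerivAt_profile hψ).add_const (c • EuclideanSpace.single (1 : Fin 3) (1 : ℝ))
  exact h

/-- `(v_c · ∇) v_c (y) = c² y₁ e₀` (the drift `c e₁` along the shear coordinate sees the
`y₁`-dependence of the profile). [cite: Acheson1990, §2.3 eq. (2.8)] -/
theorem convect_bentStream (c : ℝ) (y : E3) :
    convect (bentStream c) (bentStream c) y = (c ^ 2 * y 1) • EuclideanSpace.single (0 : Fin 3) (1 : ℝ) := by
  rw [convect_apply, (hasFDerivAt_bentStream c y).fderiv]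
  simp [bentStream, smul_smul]
  ring_nf

/-- `div v_c = 0`. [cite: Acheson1990, §2.3 eq. (2.8)] -/
theorem isDivFree_bentStream (c : ℝ) : VectorCalculus.IsDivFree (bentStream c) := by
  intro y
  rw [divergence_eq_sum_inner_fderiv (EuclideanSpace.basisFun (Fin 3) ℝ),
    (hasFDerivAt_bentStream c y).fderiv]
  simp [Fin.sum_univ_three, EuclideanSpace.inner_single_left, EuclideanSpace.basisFun_apply]

/-- `Δ v_c = c e₀`. [cite: Acheson1990, §2.3 eq. (2.9)] -/
theorem laplacian_bentStream (c : ℝ) (y : E3) :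
    Δ (bentStream c) y = c • EuclideanSpace.single (0 : Fin 3) (1 : ℝ) := by
  have hψ2 : ContDiff ℝ 2 (fun s : ℝ => c * s ^ 2 / 2) := by fun_prop
  have hprof : ContDiff ℝ 2
      (fun z : E3 => (fun s : ℝ => c * s ^ 2 / 2) (z 1) • EuclideanSpace.single (0 : Fin 3) (1 : ℝ)) :=
    (hψ2.comp (EuclideanSpace.proj (1 : Fin 3) : E3 →L[ℝ] ℝ).contDiff).smul contDiff_const
  have hsplit : bentStream c =
      (fun z : E3 => (fun s : ℝ => c * s ^ 2 / 2) (z 1) • EuclideanSpace.single (0 : Fin 3) (1 : ℝ)) +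
        fun _ : E3 => c • EuclideanSpace.single (1 : Fin 3) (1 : ℝ) := by
    funext z; rfl
  rw [hsplit, ContDiffAt.laplacian_add hprof.contDiffAt contDiff_const.contDiffAt,
    laplacian_profile hψ2, InnerProductSpace.laplacian_const]
  have hd : deriv (deriv fun s : ℝ => c * s ^ 2 / 2) = fun _ => c := by
    have h1 : deriv (fun s : ℝ => c * s ^ 2 / 2) = fun s => c * s := by
      funext s
      have h := ((hasDerivAt_pow 2 s).const_mul c).div_const 2
      rw [h.deriv]; push_cast; ring
    rw [h1]
    funext s
    have h : HasDerivAt (fun s : ℝ => c * s) c s := by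
      simpa using (hasDerivAt_id s).const_mul c
    rw [h.deriv]
  rw [hd]
  simp

/-! ### The bent stream is not a Navier–Stokes (or Euler) velocity for any pressure -/

/-- **Momentum forces the pressure gradient**: if `(u, q)` is a classical solution (any viscosity `ν`,
no force) on a time set `S ∋ t` and `u(s) = v_c` for all `s` near `t` (so `∂ₜu(t) = 0`), then
`∇q(t, y) = (ν c − c² y₁) e₀` for all `y`. [cite: Acheson1990, §2.3 eq. (2.9)] -/
theorem gradient_pressure_of_eventuallyEq_bentStream {S : Set ℝ} {ν c : ℝ} {u : ℝ → E3 → E3}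
    {q : ℝ → E3 → ℝ} (h : IsClassicalNSSolutionOn S ν 0 u q) {t : ℝ} (ht : t ∈ S)
    (hu : ∀ᶠ s in nhds t, u s = bentStream c) (y : E3) :
    gradient (q t) y = (ν * c - c ^ 2 * y 1) • EuclideanSpace.single (0 : Fin 3) (1 : ℝ) := by
  have hm := h.momentum t ht y
  have hut : u t = bentStream c := hu.self_of_nhds
  have hev : (fun s => u s y) =ᶠ[nhds t] fun _ => bentStream c y :=
    hu.mono fun s hs => by simp only [hs]
  rw [timeDerivWithin_apply, hev.derivWithin_eq_of_nhds, derivWithin_fun_const, hut,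
    convect_bentStream, laplacian_bentStream] at hm
  simp only [Pi.zero_apply, add_zero, zero_add] at hm
  have : gradient (q t) y = ν • (c • EuclideanSpace.single (0 : Fin 3) (1 : ℝ)) -
      (c ^ 2 * y 1) • EuclideanSpace.single (0 : Fin 3) (1 : ℝ) := by
    rw [hm]; abel
  rw [this]
  module

/-- **No pressure fits a velocity that is (locally in time) the bent stream**: for `c ≠ 0`, every real
`ν`, every `t ∈ S` and every `q`, a field `u` with `u(s) = v_c` for `s` near `t` is not a classical
solution on `S` with pressure `q` — the forced gradient `(ν c − c² y₁) e₀` is not a gradient (Acheson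
(2.9): a stream-wise pressure gradient depending on the shear coordinate must be constant in it).
[cite: Acheson1990, §2.3 eq. (2.9)] -/
theorem not_isClassicalNSSolutionOn_of_eventuallyEq_bentStream {S : Set ℝ} {t : ℝ} (ht : t ∈ S)
    {c : ℝ} (hc : c ≠ 0) {u : ℝ → E3 → E3} (hu : ∀ᶠ s in nhds t, u s = bentStream c) (ν : ℝ)
    (q : ℝ → E3 → ℝ) : ¬ IsClassicalNSSolutionOn S ν 0 u q := by
  intro h
  have hq : Differentiable ℝ (q t) := (h.contDiff_pressure ht).differentiable (by simp)
  have hK := eq_of_gradient_eq_smul_single hq (K := fun s => ν * c - c ^ 2 * s)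
    (fun y => gradient_pressure_of_eventuallyEq_bentStream h ht hu y) 0 1
  simp only [mul_zero, sub_zero, mul_one] at hK
  have : c ^ 2 = 0 := by linarith
  exact hc (pow_eq_zero_iff (n := 2) (by norm_num) |>.1 this)

/-- **The (steady) bent stream is not a classical Navier–Stokes / Euler velocity**: for `c ≠ 0`, every
real `ν` and every nonempty time set `S`, there is NO pressure `q` making `(v_c, q)` a classical
solution. [cite: Acheson1990, §2.3 eq. (2.9)] -/
theorem not_isClassicalNSSolutionOn_bentStream {S : Set ℝ} {t : ℝ} (ht : t ∈ S) {c : ℝ} (hc : c ≠ 0)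
    (ν : ℝ) (q : ℝ → E3 → ℝ) : ¬ IsClassicalNSSolutionOn S ν 0 (fun _ => bentStream c) q :=
  not_isClassicalNSSolutionOn_of_eventuallyEq_bentStream ht hc (Filter.Eventually.of_forall fun _ => rfl)
    ν q

/-! ### The uniform stream is an exact solution; its conjugate is not -/

/-- The uniform stream `u ≡ c e₁`, `p ≡ 0` is an unforced classical solution on every time set of
unique differentiability and for every viscosity (the rest state seen from a moving frame; tree
`FrameSlot.isClassicalNSSolutionOn_stream` with constant profile). [cite: MajdaBertozziCUP2002, §1.2] -/
theorem isClassicalNSSolutionOn_uniformStream {S : Set ℝ} (hS : UniqueDiffOn ℝ S) (ν c : ℝ) :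
    IsClassicalNSSolutionOn S ν 0 (fun (_ : ℝ) (_ : E3) => c • EuclideanSpace.single (1 : Fin 3) (1 : ℝ))
      (fun (_ : ℝ) (_ : E3) => (0 : ℝ)) := by
  have h := FrameSlot.isClassicalNSSolutionOn_stream hS
    (a := fun _ : ℝ => c • EuclideanSpace.single (1 : Fin 3) (1 : ℝ)) contDiff_const ν
  have hp : (fun (t : ℝ) (y : E3) =>
      -⟪deriv (fun _ : ℝ => c • EuclideanSpace.single (1 : Fin 3) (1 : ℝ)) t, y⟫) =
      fun (_ : ℝ) (_ : E3) => (0 : ℝ) := by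
    funext t y
    simp
  rw [hp] at h
  exact h

/-- **The conjugate of the uniform stream by the cubic shear gauge is not a solution**: for `c ≠ 0`,
every `ν`, every nonempty time set `S` and every candidate pressure `q`, the pushed-forward velocity
`t ↦ (ψ_h)_* (c e₁) = v_c` is not a classical Navier–Stokes solution.
[cite: Acheson1990, §2.3 eq. (2.9)] -/
theorem not_isClassicalNSSolutionOn_pushforward_stream {S : Set ℝ} {t : ℝ} (ht : t ∈ S) {c : ℝ}
    (hc : c ≠ 0) (ν : ℝ) (q : ℝ → E3 → ℝ) :
    ¬ IsClassicalNSSolutionOn S ν 0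
        (fun _ : ℝ => pushforward (shearMap cubic) (shearMapInv cubic)
          (fun _ : E3 => c • EuclideanSpace.single (1 : Fin 3) (1 : ℝ))) q := by
  rw [pushforward_shearMap_stream]
  exact not_isClassicalNSSolutionOn_bentStream ht hc ν q

/-- **What the gauge DOES preserve: incompressibility.** The conjugated field `v_c` is divergence-free
(the cubic shear map is volume-preserving), so the failure is in the momentum equation — the
pressure cannot absorb the conjugated inertial term — not in the constraint.
[cite: Acheson1990, §2.3 eq. (2.8)] -/
theorem isDivFree_pushforward_stream (c : ℝ) :
    VectorCalculus.IsDivFree (pushforward (shearMap cubic) (shearMapInv cubic)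
      (fun _ : E3 => c • EuclideanSpace.single (1 : Fin 3) (1 : ℝ))) := by
  rw [pushforward_shearMap_stream]
  exact isDivFree_bentStream c

/-- **What the gauge lands in: the planar class.** `v_c` is independent of `y₂` and has no
`e₂`-component — it is a «2D» field, the class where global regularity IS a theorem
(Ladyzhenskaya) — yet it is not a solution: membership of the conjugate in a regular symmetry class
says nothing unless the conjugate solves the (Euclidean) equations (a plane parallel profile plus a
uniform drift, Acheson's (2.8) geometry). [cite: Acheson1990, §2.3 eq. (2.8)] -/
theorem bentStream_planar (c : ℝ) (y : E3) (s : ℝ) :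
    bentStream c (y + s • EuclideanSpace.single (2 : Fin 3) (1 : ℝ)) = bentStream c y ∧
      bentStream c y 2 = 0 := by
  constructor
  · simp [bentStream]
  · simp [bentStream]

end Literature.Barriers.NavierStokesRegularity.DiffeoGauge

end
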